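import Summits.BirchSwinnertonDyer.BirchSwinnertonDyer.Theses.CumulativeHeegnerLeopoldt
import Summits.BirchSwinnertonDyer.BirchSwinnertonDyer.Theorems.CumulativeHeegnerLeopoldtResidualSelmerFiniteAtThreeOfPrint
import Summits.BirchSwinnertonDyer.BirchSwinnertonDyer.Theorems.CumulativeHeegnerLeopoldtCumulativeHeegnerInclusionAtThreeGlue
import Summits.BirchSwinnertonDyer.BirchSwinnertonDyer.Theorems.CumulativeHeegnerLeopoldtCumulativeHeegnerInclusionAtThreeStubThreeSaturation
import Summits.BirchSwinnertonDyer.BirchSwinnertonDyer.Theorems.UniversalToricDescentAcDualMuZeroCriterion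
import HarnessLib

/-!
# Crux K1 `CumulativeHeegnerInclusionAtThree` (stmt-BirchSwinnertonDyer-24198) of route
# `CumulativeHeegnerLeopoldt` (rev 5) — LINE `birth`, v5 (lead prover bsd-line-chl-k1-p1 g3; v1 planner
# bsd-wall-pss3 g10, v2 lead bsd-line-chl-p1 g0, v3 lead bsd-line-chl-k1-p1 g0, v4 lead bsd-line-chl-k1-p1 g2)

v5 = v4 re-published against the LANDED kernel items of the rev-5 split of K1 (A = crux stmt-26896
`TemperedHeegnerInclusionAtThree`, P = print support stmt-26897 `ResidualSelmerPrintedInputAtThree`, B1P = stmt-26898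
CLOSED p616187, glue = stmt-26899 CLOSED p615902). The crux (span{L} ⊆ Ch_Λ(X_{∅,0}) · R₀⟦T⟧ at the frame
(κ, γ, 𝔭, 𝔭′, ι′, L) on the Leopoldt cell) is composed from exactly TWO registered stubs:

* STUB A `stub_temperedInclusion` (XL, load-bearing, OPEN — research; = the text of crux stmt-26896 VERBATIM): the
  TEMPERED inclusion span(3^μ·L) ⊆ Ch for SOME μ — the rational (Λ[1/3]) anticyclotomic BDP divisibility at the
  additive prime 3 on the reducible non-anomalous cell; beyond print (leads g0/g2: promote-stub; -w2 audit
  evidence #28: object deficit = Heegner points of 3-power conductor at 9 ∣ N, temper of the cumulative class = 1,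
  principal-series / supercuspidal split of the cell).
* STUB P `stub_residualCharacterSelmerFinite` (PRINT, OPEN by design — = support stmt-26897 BY NAME): the Literature
  named fact `CastellaGrossiLeeSkinner2022.prop14_residualCharacterSelmer_finite` (CGLS, Invent. Math. 227 (2022)
  §1.2 Prop. 14: residual Greenberg Selmer group of a non-anomalous character over K_∞^{ac} is finite; Rubin 1991 +
  Hida 2010 / Oukhaba–Viguié at 3). Closes only by formalising that print.
* B1 `stub_residualSelmerFinite` is a THEOREM: the landed closer of B1P
  (`Theorems.cumulativeHeegnerLeopoldt_residualSelmerFiniteAtThreeOfPrint_proof`, p616187) applied to P.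
* B `stub_charPrincipalMuZero` is a THEOREM from B1 (UTD Greenberg criterion
  `UniversalToricDescentAcDualMuZero.isTorsion_and_exists_generator_of_finite_pTorsion`, as in v3).
* C `stub_threeSaturation`: LANDED (p595383), cited by name.

`CumulativeHeegnerInclusionAtThree_of` concludes the route decl BY NAME (explicit A → B → C composition);
`CumulativeHeegnerInclusionAtThree_of'` is the same conclusion through the landed glue of the split (p615902).
Sorries only in `stub_temperedInclusion` / `stub_residualCharacterSelmerFinite`. K1 = A + print.
BSD is not proved by any of this.
-/

set_option linter.dupNamespace false
set_option autoImplicit false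

noncomputable section

open scoped Classical

namespace Summit.BirchSwinnertonDyer.BirchSwinnertonDyer.Cruxes.CumulativeHeegnerInclusionAtThree.Birth

open Literature.NumberTheory.EllipticCurves NumberField IsDedekindDomain Field
  Summit.BirchSwinnertonDyer.Rank1Residual.X11b Summit.BirchSwinnertonDyer.Rank1Residual.X11b.AcSelmer

/-- STUB A (LOAD-BEARING, XL; also the BC5 PLAN-ONLY rung): the TEMPERED inclusion — the
cumulative Heegner class κ♮ (norm-compatible because a₃ = 0 ⇒ Tr y_(3^(k+1)) = 0), its Leopoldt
reciprocity Col♮(loc κ♮) ≐ ℒ_𝔭 (Lettl 1998 Thm 1 + Liu–Zhang–Zhang at finite-order characters) and the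
Howard/CGS-6.5.2-type Kolyvagin-system bound with E(K)[3] = 0 give span(3^μ·L) ⊆ char X for SOME μ. -/
theorem stub_temperedInclusion :
    ∀ (W : WeierstrassCurve ℚ) [W.IsElliptic] [W.IsGloballyMinimal] (N : ℕ) [NeZero N] (K : Type) [Field K] [NumberField K] (Dt : Literature.NumberTheory.EllipticCurves.ModularForms.ModularParametrizationData W N), Summit.BirchSwinnertonDyer.Rank1Residual.Additive.ClassO6 W 3 → Literature.NumberTheory.EllipticCurves.Rank1Residual.Red W 3 → (∃ Φ : AddSubgroup (WeierstrassCurve.geomTorsion W ((3 : ℕ) : ℤ)), Literature.NumberTheory.EllipticCurves.Rank1Residual.IsRationalLine W 3 Φ ∧ ∀ (v : IsDedekindDomain.HeightOneSpectrum (NumberField.RingOfIntegers ℚ)), ((3 : ℕ) : NumberField.RingOfIntegers ℚ) ∈ v.asIdeal → ∀ 𝔓 ∈ v.primesAbove, ¬ (∀ g ∈ 𝔓.decompositionSubgroup (Field.absoluteGaloisGroup ℚ), ∀ P ∈ Φ, g • P = P) ∧ ¬ (∀ g ∈ 𝔓.decompositionSubgroup (Field.absoluteGaloisGroup ℚ),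 ∀ P : WeierstrassCurve.geomTorsion W ((3 : ℕ) : ℤ), g • P - P ∈ Φ)) → W.analyticRank = 1 → W.conductorNorm ℤ = N → Literature.NumberTheory.EllipticCurves.IsImaginaryQuadratic K → Literature.NumberTheory.EllipticCurves.SatisfiesHeegnerHypothesis N K → ∀ (κ : Literature.NumberTheory.EllipticCurves.ZpExtension K 3), κ.IsAnticyclotomic → ∀ (γ : Field.absoluteGaloisGroup K) [Fact (κ.IsTopGenerator γ)] (𝔭 : IsDedekindDomain.HeightOneSpectrum (NumberField.RingOfIntegers K)), ((3 : ℕ) : NumberField.RingOfIntegers K) ∈ 𝔭.asIdeal → 𝔭.asIdeal.ramificationIdx (NumberField.RingOfIntegers ℚ) = 1 → 𝔭.asIdeal.inertiaDeg (NumberField.RingOfIntegers ℚ) = 1 → ∀ (𝔭' : IsDedekindDomain.HeightOneSpectrum (NumberField.RingOfIntegers K)), ((3 : ℕ) : NumberField.RingOfIntegers K) ∈ 𝔭'.asIdeal → 𝔭' ≠ 𝔭 → ∀ (ι' : PadicAlgCl 3 ≃+* ℂ), Summit.BirchSwinnertonDyer.BirchSwinnertonDyer.Theorems.SchneiderFree.BranchInducesPrime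 3 ι' 𝔭 → ∀ (ΩK : ℂ) (Ωp : ℂ_[3]) (L : Literature.NumberTheory.EllipticCurves.UnrSeries 3), ΩK ≠ 0 → Ωp ≠ 0 → Literature.NumberTheory.EllipticCurves.IsBDPLFunction ι' 𝔭 κ γ Dt.f ΩK Ωp L → ∃ μ : ℕ, Ideal.span {(3 : Literature.NumberTheory.EllipticCurves.UnrSeries 3) ^ μ * L} ≤ (Summit.BirchSwinnertonDyer.Rank1Residual.X11b.AcSelmer.XAc.charIdeal (W.baseChange K) 3 κ 𝔭' ∅ γ).map (PowerSeries.map (Summit.BirchSwinnertonDyer.Rank1Residual.X11b.Halves.toUnr 3)) := by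
  sorry

/-- STUB P (PRINT; = support item stmt-BirchSwinnertonDyer-26897 `ResidualSelmerPrintedInputAtThree` BY NAME):
Castella–Grossi–Lee–Skinner, Invent. Math. 227 (2022) §1.2 Prop. 14 — for `p` odd split in the imaginary quadratic
`K`, a character module of order `p` unramified outside a finite split set `S ∌ p` and non-anomalous at `𝔭`
(`θ|G_𝔭 ∉ {1, ω}`), the residual `S`-imprimitive Greenberg Selmer group over `K_∞^{ac}` is finite (Rubin 1991 main
conjecture + `μ = 0`). Typed as the Literature named fact (p610776); a print input, open until that print is
formalised. -/
theorem stub_residualCharacterSelmerFinite :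
    Literature.NumberTheory.EllipticCurves.CastellaGrossiLeeSkinner2022.prop14_residualCharacterSelmer_finite := by
  sorry

/-- B1 (former STUB B1 of v3, now a THEOREM): **residual-Selmer finiteness on the Leopoldt cell** —
`Sel_{𝔭′}(K_∞, E[3^∞])[3]` (Castella's anticyclotomic Selmer group: strict at `𝔭′`, relaxed at the other prime
above `3`, `Σ = ∅`) is finite. Proof: the landed closer of support item B1P stmt-26898
(`cumulativeHeegnerLeopoldt_residualSelmerFiniteAtThreeOfPrint_proof`, p616187: residual devissage along the
rational line, Kummer step, degree-one transport of the non-anomalous clause, Weil determinant on the line, split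
bad places) applied to STUB P. -/
theorem stub_residualSelmerFinite :
    ∀ (W : WeierstrassCurve ℚ) [W.IsElliptic] [W.IsGloballyMinimal] (N : ℕ) [NeZero N] (K : Type) [Field K] [NumberField K], Summit.BirchSwinnertonDyer.Rank1Residual.Additive.ClassO6 W 3 → Literature.NumberTheory.EllipticCurves.Rank1Residual.Red W 3 → (∃ Φ : AddSubgroup (WeierstrassCurve.geomTorsion W ((3 : ℕ) : ℤ)), Literature.NumberTheory.EllipticCurves.Rank1Residual.IsRationalLine W 3 Φ ∧ ∀ (v : IsDedekindDomain.HeightOneSpectrum (NumberField.RingOfIntegers ℚ)), ((3 : ℕ) : NumberField.RingOfIntegers ℚ) ∈ v.asIdeal → ∀ 𝔓 ∈ v.primesAbove, ¬ (∀ g ∈ 𝔓.decompositionSubgroup (Field.absoluteGaloisGroup ℚ), ∀ P ∈ Φ, g • P = P) ∧ ¬ (∀ g ∈ 𝔓.decompositionSubgroup (Field.absoluteGaloisGroup ℚ), ∀ P : WeierstrassCurve.geomTorsion W ((3 : ℕ) : ℤ), g • P - P ∈ Φ)) → W.conductorNorm ℤ = N → Literature.NumberTheory.EllipticCurves.IsImaginaryQuadratic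 K → Literature.NumberTheory.EllipticCurves.SatisfiesHeegnerHypothesis N K → ∀ (κ : Literature.NumberTheory.EllipticCurves.ZpExtension K 3), κ.IsAnticyclotomic → ∀ (𝔭' : IsDedekindDomain.HeightOneSpectrum (NumberField.RingOfIntegers K)), ((3 : ℕ) : NumberField.RingOfIntegers K) ∈ 𝔭'.asIdeal → Set.Finite {s : Summit.BirchSwinnertonDyer.Rank1Residual.X11b.AcSelmer.selmerAc (W.baseChange K) 3 κ 𝔭' ∅ | (3 : ℕ) • s = 0} :=
  Summit.BirchSwinnertonDyer.BirchSwinnertonDyer.Theorems.cumulativeHeegnerLeopoldt_residualSelmerFiniteAtThreeOfPrint_proof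
    stub_residualCharacterSelmerFinite


/-- Former STUB B `stub_charPrincipalMuZero`, PROVED from B1 (hence from STUB P): char X_(∅,0)·R₀⟦T⟧ is principal with a
generator having SOME norm-one coefficient (μ_alg = 0). Proof: residual finiteness (B1) ⟹ Greenberg's
criterion on the constructed dual (`UniversalToricDescentAcDualMuZero.isTorsion_and_exists_generator_of_finite_pTorsion`:
`X` torsion, `μ(X) = 0`, `Ch` principal over the UFD `Λ`, a coefficient of the generator is a unit, `‖toUnr x‖ = ‖x‖`). -/
theorem stub_charPrincipalMuZero :
    ∀ (W : WeierstrassCurve ℚ) [W.IsElliptic] [W.IsGloballyMinimal] (N : ℕ) [NeZero N] (K : Type) [Field K] [NumberField K] (Dt : Literature.NumberTheory.EllipticCurves.ModularForms.ModularParametrizationData W N), Summit.BirchSwinnertonDyer.Rank1Residual.Additive.ClassO6 W 3 → Literature.NumberTheory.EllipticCurves.Rank1Residual.Red W 3 → (∃ Φ : AddSubgroup (WeierstrassCurve.geomTorsion W ((3 : ℕ) : ℤ)), Literature.NumberTheory.EllipticCurves.Rank1Residual.IsRationalLine W 3 Φ ∧ ∀ (v : IsDedekindDomain.HeightOneSpectrum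 (NumberField.RingOfIntegers ℚ)), ((3 : ℕ) : NumberField.RingOfIntegers ℚ) ∈ v.asIdeal → ∀ 𝔓 ∈ v.primesAbove, ¬ (∀ g ∈ 𝔓.decompositionSubgroup (Field.absoluteGaloisGroup ℚ), ∀ P ∈ Φ, g • P = P) ∧ ¬ (∀ g ∈ 𝔓.decompositionSubgroup (Field.absoluteGaloisGroup ℚ), ∀ P : WeierstrassCurve.geomTorsion W ((3 : ℕ) : ℤ), g • P - P ∈ Φ)) → W.analyticRank = 1 → W.conductorNorm ℤ = N → Literature.NumberTheory.EllipticCurves.IsImaginaryQuadratic K → Literature.NumberTheory.EllipticCurves.SatisfiesHeegnerHypothesis N K → ∀ (κ : Literature.NumberTheory.EllipticCurves.ZpExtension K 3), κ.IsAnticyclotomic → ∀ (γ : Field.absoluteGaloisGroup K) [Fact (κ.IsTopGenerator γ)] (𝔭 : IsDedekindDomain.HeightOneSpectrum (NumberField.RingOfIntegers K)), ((3 : ℕ) : NumberField.RingOfIntegers K) ∈ 𝔭.asIdeal → 𝔭.asIdeal.ramificationIdx (NumberField.RingOfIntegers ℚ) = 1 → 𝔭.asIdeal.inertiaDeg (NumberField.RingOfIntegers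 ℚ) = 1 → ∀ (𝔭' : IsDedekindDomain.HeightOneSpectrum (NumberField.RingOfIntegers K)), ((3 : ℕ) : NumberField.RingOfIntegers K) ∈ 𝔭'.asIdeal → 𝔭' ≠ 𝔭 → ∀ (ι' : PadicAlgCl 3 ≃+* ℂ), Summit.BirchSwinnertonDyer.BirchSwinnertonDyer.Theorems.SchneiderFree.BranchInducesPrime 3 ι' 𝔭 → ∀ (ΩK : ℂ) (Ωp : ℂ_[3]) (L : Literature.NumberTheory.EllipticCurves.UnrSeries 3), ΩK ≠ 0 → Ωp ≠ 0 → Literature.NumberTheory.EllipticCurves.IsBDPLFunction ι' 𝔭 κ γ Dt.f ΩK Ωp L → ∃ (g : Literature.NumberTheory.EllipticCurves.UnrSeries 3) (n : ℕ), (Summit.BirchSwinnertonDyer.Rank1Residual.X11b.AcSelmer.XAc.charIdeal (W.baseChange K) 3 κ 𝔭' ∅ γ).map (PowerSeries.map (Summit.BirchSwinnertonDyer.Rank1Residual.X11b.Halves.toUnr 3)) = Ideal.span {g} ∧ ‖((PowerSeries.coeff n g : Literature.NumberTheory.EllipticCurves.unrIntegers 3) : ℂ_[3])‖ = 1 :=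 by
  intro W _ _ N _ K _ _ Dt hO6 hRed hcell _hr hN hK hHg κ hκ γ _ 𝔭 _h𝔭 _he _hf 𝔭' h𝔭' _hne ι' _hι ΩK Ωp L _hΩK
    _hΩp _hBDP
  haveI : (W.baseChange K).IsElliptic := inferInstanceAs (W.map (algebraMap ℚ K)).IsElliptic
  have hfin := stub_residualSelmerFinite W N K hO6 hRed hcell hN hK hHg κ hκ 𝔭' h𝔭'
  obtain ⟨_, g, hg, n, hn⟩ :=
    Summit.BirchSwinnertonDyer.BirchSwinnertonDyer.Theorems.UniversalToricDescentAcDualMuZero.isTorsion_and_exists_generator_of_finite_pTorsion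
      (W.baseChange K) 3 κ 𝔭' ∅ γ Set.finite_empty hfin
  exact ⟨g, n, hg, hn⟩

/-- STUB C (M, provable now; pure algebra in Λ^ur = 𝒪^ur⟦T⟧): (3) is prime in 𝒪^ur⟦T⟧, so a
generator with a unit coefficient is prime to 3 and span(3^μ·L) ⊆ (g) forces span(L) ⊆ (g). LANDED p595383. -/
theorem stub_threeSaturation :
    ∀ (L g : Literature.NumberTheory.EllipticCurves.UnrSeries 3) (μ n : ℕ), ‖((PowerSeries.coeff n g : Literature.NumberTheory.EllipticCurves.unrIntegers 3) : ℂ_[3])‖ = 1 → Ideal.span {(3 : Literature.NumberTheory.EllipticCurves.UnrSeries 3) ^ μ * L} ≤ Ideal.span {g} → Ideal.span {L} ≤ Ideal.span {g} := by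
  exact Summit.BirchSwinnertonDyer.BirchSwinnertonDyer.Theorems.CumulativeHeegnerInclusionAtThreeSaturation.stub_threeSaturation

/-- COMPOSITION (line `birth`, kernel-checked): STUB A → (STUB P ⟹ B1 ⟹ B) → C ⟹ the route crux
`CumulativeHeegnerInclusionAtThree` BY NAME (at the frame: A gives span(3^μ L) ⊆ Ch, B gives Ch = (g) with a unit
coefficient, C saturates). -/
theorem CumulativeHeegnerInclusionAtThree_of :
    Summit.BirchSwinnertonDyer.BirchSwinnertonDyer.Theses.CumulativeHeegnerLeopoldt.CumulativeHeegnerInclusionAtThree := by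
  intro W _ _ N _ K _ _ Dt hO6 hRed hcell hr hN hK hHg κ hκ γ _ 𝔭 h𝔭 he hf 𝔭' h𝔭' hne ι' hι ΩK Ωp L hΩK hΩp hBDP
  obtain ⟨μ, hμ⟩ := stub_temperedInclusion W N K Dt hO6 hRed hcell hr hN hK hHg κ hκ γ 𝔭 h𝔭 he hf 𝔭' h𝔭' hne ι' hι
    ΩK Ωp L hΩK hΩp hBDP
  obtain ⟨g, n, hg, hunit⟩ := stub_charPrincipalMuZero W N K Dt hO6 hRed hcell hr hN hK hHg κ hκ γ 𝔭 h𝔭 he hf 𝔭'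
    h𝔭' hne ι' hι ΩK Ωp L hΩK hΩp hBDP
  rw [hg] at hμ ⊢
  exact stub_threeSaturation L g μ n hunit hμ

/-- The same conclusion through the LANDED glue of the rev-5 split (stmt-26899, p615902):
`TemperedHeegnerInclusionAtThree → ResidualSelmerPrintedInputAtThree → ResidualSelmerFiniteAtThreeOfPrint →
CumulativeHeegnerInclusionAtThree`, fed with STUB A (its text IS `TemperedHeegnerInclusionAtThree`), STUB P and
the landed B1P closer. Kernel check that the line and the kernel split agree. -/
theorem CumulativeHeegnerInclusionAtThree_of' :
    Summit.BirchSwinnertonDyer.BirchSwinnertonDyer.Theses.CumulativeHeegnerLeopoldt.CumulativeHeegnerInclusionAtThree :=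
  Summit.BirchSwinnertonDyer.BirchSwinnertonDyer.Theorems.cumulativeHeegnerLeopoldt_cumulativeHeegnerInclusionAtThreeGlue_proof
    stub_temperedInclusion stub_residualCharacterSelmerFinite
    Summit.BirchSwinnertonDyer.BirchSwinnertonDyer.Theorems.cumulativeHeegnerLeopoldt_residualSelmerFiniteAtThreeOfPrint_proof

end Summit.BirchSwinnertonDyer.BirchSwinnertonDyer.Cruxes.CumulativeHeegnerInclusionAtThree.Birth

end
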